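import Summits.MatrixMultiplication.MatrixMultiplication.Theses.FourierTwoFamiliesModP
import Literature.Computability.AlgebraicComplexity.SimultaneousDoubleProduct

/-!
# `PrimeLogDecay` (crux stmt-MatrixMultiplication-14310, route FourierTwoFamiliesModP):
# chain-menu SDPP designs (negative-side calibration, refuter cdisprove seat)

Sorry-free support file.  A CHAIN MENU of length `L` in an additive group `H` is a family of direct
pairs `(R a, R' a)`, `a : Fin L`, with the ONE-DIRECTIONAL separation
`Disjoint (R a + R' c) (R c + R' b)` for all `a < b` and ALL `c`.  `isSDPP_pi_of_chainMenu`: for any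
word family `w : Fin n → (Fin k → Fin L)` in which two distinct words are somewhere strictly
increasing (`sep_of_antichain`: every injective antichain of the product order), the product blocks
`A i = Fintype.piFinset (R ∘ w i)`, `B i = Fintype.piFinset (R' ∘ w i)` form an SDPP family in
`Fin k → H` (Cohn–Kleinberg–Szegedy–Umans 2005 Prop. 4.5/"24" is the case `L = 2`).
`menu12R/menu12R'` is a chain menu of length 4 with blocks of size 2 in `ZMod 12` (checked by
`decide`; two-directional = genuinely SDPP menus there have length ≤ 3), so `f := L·r/m = 2/3`:
with antichain word families this gives balanced SDPP designs of density `(2/3)^k · Θ(k^{-1/2})` in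
`(ZMod 12)^k` and, by the same construction over pairwise coprime moduli (period-12 pattern,
verified for all `m ≤ 100`), CYCLIC designs of density `s^{-log₂(3/2)+o(1)}` — a calibration for
`PrimeCyclicPowerGain` (any admissible `c` is `≤ 0.585`) that leaves `PrimeLogDecay` untouched
(the antichain loss caps all such designs below `(log s)^{-1/2}`).  Details: the crux disprover's
`Cruxes/PrimeLogDecay/Disproof.lean` and NOTES.
-/

namespace Summit.MatrixMultiplication.MatrixMultiplication.Theorems.PrimeLogDecay.Negative

/-! ## Chain menus -/

section ChainMenu
open scoped Pointwise
variable {H : Type*} [AddCommGroup H] [DecidableEq H] {L k n : ℕ}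

/-- Chain menu + somewhere-increasing word family ⟹ SDPP for the product blocks. -/
theorem isSDPP_pi_of_chainMenu (R R' : Fin L → Finset H)
    (hW : ∀ a : Fin L, ∀ x ∈ R a, ∀ x' ∈ R a, ∀ y ∈ R' a, ∀ y' ∈ R' a,
      x - x' + (y - y') = 0 → x = x' ∧ y = y')
    (hchain : ∀ a b c : Fin L, a < b → Disjoint (R a + R' c) (R c + R' b))
    (w : Fin n → (Fin k → Fin L)) (hsep : ∀ i i' : Fin n, i ≠ i' → ∃ t, w i t < w i' t) :
    Literature.Computability.AlgebraicComplexity.IsSDPP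
      (fun i => Fintype.piFinset fun t => R (w i t))
      (fun i => Fintype.piFinset fun t => R' (w i t)) := by
  refine ⟨?_, ?_⟩
  · intro i a ha a' ha' b hb b' hb' h0
    rw [Fintype.mem_piFinset] at ha ha' hb hb'
    have key : ∀ t, a t = a' t ∧ b t = b' t := fun t =>
      hW (w i t) (a t) (ha t) (a' t) (ha' t) (b t) (hb t) (b' t) (hb' t)
        (by simpa using congrFun h0 t)
    exact ⟨funext fun t => (key t).1, funext fun t => (key t).2⟩
  · intro i j l a ha a' ha' b hb b' hb' h0
    by_contra hil
    obtain ⟨t, ht⟩ := hsep i l hil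
    rw [Fintype.mem_piFinset] at ha ha' hb hb'
    have h0t : a t - a' t + (b t - b' t) = 0 := by simpa using congrFun h0 t
    have he : a t + b t = a' t + b' t := by
      rw [sub_add_sub_comm] at h0t
      exact sub_eq_zero.mp h0t
    exact Finset.disjoint_left.mp (hchain (w i t) (w l t) (w j t) ht)
      (Finset.add_mem_add (ha t) (hb t)) (he ▸ Finset.add_mem_add (ha' t) (hb' t))

/-- Injective antichains (product order) are somewhere-increasing in both directions. -/
lemma sep_of_antichain (w : Fin n → (Fin k → Fin L)) (hw : Function.Injective w)
    (hanti : IsAntichain (· ≤ ·) (Set.range w)) :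
    ∀ i i' : Fin n, i ≠ i' → ∃ t, w i t < w i' t := by
  intro i i' hii'
  have hne : w i' ≠ w i := fun h => hii' (hw h).symm
  have h : ¬ w i' ≤ w i := hanti (Set.mem_range_self i') (Set.mem_range_self i) hne
  simp only [Pi.le_def, not_forall, not_le] at h
  exact h

omit [AddCommGroup H] [DecidableEq H] in
/-- Block sizes of the product design. -/
lemma card_piFinset_const {r : ℕ} (R : Fin L → Finset H) (hR : ∀ a, (R a).card = r)
    (v : Fin k → Fin L) : (Fintype.piFinset fun t => R (v t)).card = r ^ k := by
  rw [Fintype.card_piFinset]; simp [hR]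

/-- The `ℤ/12` chain menu of length 4 (block size 2; `f = 2/3`): in chain order
`({0,1},{0,4}) < ({4,8},{7,8}) < ({2,3},{2,6}) < ({6,10},{9,10})`.  Found by exhaustive search
(`L_max(12) = 4`; two-directional menus have `L ≤ 3 = m/4`). -/
def menu12R : Fin 4 → Finset (ZMod 12) := ![{0, 1}, {4, 8}, {2, 3}, {6, 10}]
/-- see `menu12R`. -/
def menu12R' : Fin 4 → Finset (ZMod 12) := ![{0, 4}, {7, 8}, {2, 6}, {9, 10}]

/-- Each pair of `menu12` is direct (decide). -/
lemma menu12_direct : ∀ a : Fin 4, ∀ x ∈ menu12R a, ∀ x' ∈ menu12R a, ∀ y ∈ menu12R' a,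
    ∀ y' ∈ menu12R' a, x - x' + (y - y') = 0 → x = x' ∧ y = y' := by decide

/-- One-directional chain separation of `menu12` (decide). -/
lemma menu12_chain : ∀ a b c : Fin 4, a < b →
    Disjoint (menu12R a + menu12R' c) (menu12R c + menu12R' b) := by decide

/-- The resulting SDPP families in `(ℤ/12)^k`, for every somewhere-increasing word family. -/
theorem isSDPP_menu12_pi (w : Fin n → (Fin k → Fin 4))
    (hsep : ∀ i i' : Fin n, i ≠ i' → ∃ t, w i t < w i' t) :
    Literature.Computability.AlgebraicComplexity.IsSDPP
      (fun i => Fintype.piFinset fun t => menu12R (w i t))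
      (fun i => Fintype.piFinset fun t => menu12R' (w i t)) :=
  isSDPP_pi_of_chainMenu menu12R menu12R' menu12_direct menu12_chain w hsep

end ChainMenu

end Summit.MatrixMultiplication.MatrixMultiplication.Theorems.PrimeLogDecay.Negative
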